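import Summits.CriticalPhenomena.PercolationContinuityZ3.Theorems.Transplant.BccSkeletonConc
import Mathlib.Tactic.FinCases
import Mathlib.Tactic.Ring
import HarnessLib

/-!
# The DIAMOND lattice (class C1b, row F), I: the structure in the bcc integer frame, its `[001]` skeleton onto the square net
# (exactly one bond per skeleton direction), the frames (even translations and glides) and vertex-transitivity

builds on p205010 (kernel theorem, internal audit signed; external expert review pending).
Status sentence (coordinator 2026-08-20T04:30Z): "θ(p_c) = 0 on ℤ^d, all d ≥ 2 — kernel-verified (Lean 4/Mathlib,
standard axioms); internal adversarial audit SIGNED 2026-08-20 04:29Z; external expert review pending."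

Lane `prim-bschramm-*`, seat `prim-bschramm-p2` (gen 6; class C1b "other 3D lattices at their own critical points", METHOD = input
substitution; a FOURTH row-F lattice next to fcc / bcc / the stacked triangular lattice).  The **diamond structure** is Conway–Sloane's
`D₃⁺ = D₃ ∪ (D₃ + (½,½,½))`; in the integer frame of the tree's bcc lattice (`StatementCubicLattices.lean`: `bccSite = 2ℤ³ ∪ (2ℤ³+(1,1,1))`,
bonds `(±1,±1,±1)`) it is `2D₃ ∪ (2D₃ + (1,1,1)) = {x ∈ ℤ³ : x₀ ≡ x₁ ≡ x₂ (mod 2), x₀+x₁+x₂ ≡ 0 or 3 (mod 4)}` — the eight sites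
`(0,0,0),(0,2,2),(2,0,2),(2,2,0),(1,1,1),(1,3,3),(3,1,3),(3,3,1)` of the conventional cubic cell of side `4` — with the bcc bonds between
them: from an even site the four bonds `(1,1,1),(1,-1,-1),(-1,1,-1),(-1,-1,1)`, from an odd site their negatives.  So `diamondGraph` is a
`4`-regular INDUCED subgraph of `bccGraph` and the whole bcc toolbox (`CubicLatticesSkeleton/Cylinder`, `BccPlanarSkeleton`, `BccSkeletonConc`)
applies through the inclusion `toBcc`.
* `diamondSkel = bccSkel ∘ toBcc = ((x₀+x₁)/2, (x₀−x₁)/2)` — the projection along `[001]` onto the square net: at EVERY site there is EXACTLY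
  one bond per skeleton direction `±e₀, ±e₁` (`bondVec`, `bondEnd`, `diamond_step`; from an even site east/west bonds go up in `x₂` and
  north/south bonds go down, from an odd site the reverse), so `diamondSkel` maps neighbourhoods ONTO neighbourhoods (`diamondSkel_surjOn`:
  a weak covering map `diamond → ℤ²`, used in part II for `p_c(diamond) ≤ p_c(ℤ²)`).
* FRAMES `diamondFrame v : w ↦ (w₀+v₀, w₁+v₁, ±w₂+v₂)` (sign `+`: an even translation; sign `−`: a GLIDE of the non-symmorphic diamond
  space group) are automorphisms carrying the origin to `v` and translating the skeleton (`diamondSkel_frame`); hence the diamond lattice is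
  vertex-transitive (`isPretransitive_aut_diamond`) and quasi-transitive, with ONE base vertex for the planar skeleton of part II
  (`DiamondSkeletonConc.lean`: point group, cylinders, `p_c < 1`, the target `DiamondOwnCriticalContinuity` and its reduction to the lane's node).
[cite: ConwaySloane1999, Ch. 4 §7.3 (the packing D₃⁺ = diamond) and §7.1 (D_n, D_n^*)] [cite: BenjaminiSchramm1996, §2 and Thm. 1]
[cite: KozmaNitzan2024, §4 p. 15 (the role of the symmetries of ℤ^d)]
-/

noncomputable section

namespace Summit.CriticalPhenomena.PercolationContinuityZ3.Theorems.Transplant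

open MeasureTheory Literature.Probability.Percolation Literature.Probability.LatticeModels SimpleGraph
open Literature.Probability.Percolation.GM (HOct sp)
open Literature.Barriers.CriticalPhenomena (IsQuasiTransitive IsGraphAmenable)

/-! ## §1 The diamond structure inside the bcc frame -/

/-- **The vertex set of the diamond structure** in the bcc integer frame: `x₀ ≡ x₁ ≡ x₂ (mod 2)` and `x₀ + x₁ + x₂ ≡ 0 or 3 (mod 4)`, i.e.
`2D₃ ∪ (2D₃ + (1,1,1))` (Conway–Sloane `D₃⁺` scaled by `2`). [cite: ConwaySloane1999, Ch. 4 §7.3 (D₃⁺ = diamond)] -/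
def diamondSite : Set (Site 3) :=
  {x | x 0 % 2 = x 2 % 2 ∧ x 1 % 2 = x 2 % 2 ∧ ((x 0 + x 1 + x 2) % 4 = 0 ∨ (x 0 + x 1 + x 2) % 4 = 3)}

/-- Membership in `diamondSite`. [folklore] -/
theorem mem_diamondSite_iff (x : Site 3) :
    x ∈ diamondSite ↔ x 0 % 2 = x 2 % 2 ∧ x 1 % 2 = x 2 % 2 ∧ ((x 0 + x 1 + x 2) % 4 = 0 ∨ (x 0 + x 1 + x 2) % 4 = 3) :=
  Iff.rfl

/-- The origin is a diamond site. [folklore] -/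
theorem zero_mem_diamondSite : (0 : Site 3) ∈ diamondSite := by
  simp [mem_diamondSite_iff]

/-- **Diamond sites are bcc sites** (all coordinates even, or all odd). [cite: ConwaySloane1999, Ch. 4 §7.3] -/
theorem diamondSite_subset_bccSite : diamondSite ⊆ bccSite := by
  intro x hx
  obtain ⟨h0, h1, -⟩ := hx
  rw [mem_bccSite_iff]
  rcases Int.emod_two_eq_zero_or_one (x 2) with h2 | h2
  · refine Or.inl fun i => ?_
    rw [Int.even_iff]
    rcases (show i = 0 ∨ i = 1 ∨ i = 2 by fin_cases i <;> simp) with rfl | rfl | rfl <;> omega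
  · refine Or.inr fun i => ?_
    rw [Int.odd_iff]
    rcases (show i = 0 ∨ i = 1 ∨ i = 2 by fin_cases i <;> simp) with rfl | rfl | rfl <;> omega

/-- A diamond site viewed as a bcc site. [folklore] -/
def toBcc (x : diamondSite) : bccSite := ⟨x, diamondSite_subset_bccSite x.2⟩

/-- Coordinates of `toBcc`. [folklore] -/
@[simp] theorem coe_toBcc (x : diamondSite) : ((toBcc x : bccSite) : Site 3) = (x : Site 3) := rfl

/-- **The diamond lattice as a graph**: diamond sites joined by the bcc bonds `(±1,±1,±1)` (squared length `3`); an induced subgraph of the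
bcc lattice, `4`-regular. [cite: ConwaySloane1999, Ch. 4 §7.3 (D₃⁺ = diamond)] -/
def diamondGraph : SimpleGraph diamondSite :=
  (distSqGraph 3 3).induce diamondSite

/-- The origin of the diamond lattice. [folklore] -/
def diamondOrigin : diamondSite := ⟨0, zero_mem_diamondSite⟩

/-- `toBcc` of the origin. [folklore] -/
@[simp] theorem toBcc_origin : toBcc diamondOrigin = bccOrigin := rfl

/-- Adjacency in the diamond lattice is bcc adjacency of the underlying sites. [folklore] -/
theorem diamondGraph_adj (x y : diamondSite) : diamondGraph.Adj x y ↔ bccGraph.Adj (toBcc x) (toBcc y) := Iff.rfl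

/-- Adjacency in ambient terms: distinct points at squared distance `3`. [folklore] -/
theorem diamondGraph_adj' (x y : diamondSite) :
    diamondGraph.Adj x y ↔ (x : Site 3) ≠ y ∧ ∑ i, ((x : Site 3) i - (y : Site 3) i) ^ 2 = 3 := Iff.rfl

/-- The diamond lattice is locally finite. [folklore] -/
instance diamondGraph_locallyFinite : diamondGraph.LocallyFinite := distSqGraph_induce_locallyFinite 3 3 diamondSite

/-- Along a diamond bond all three coordinates change by exactly `±1`. [cite: ConwaySloane1999, Ch. 4 §7.3] -/
theorem diamond_abs_sub_eq_one {x y : diamondSite} (h : diamondGraph.Adj x y) (i : Fin 3) :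
    |(x : Site 3) i - (y : Site 3) i| = 1 :=
  bcc_abs_sub_eq_one (x := toBcc x) (y := toBcc y) h i

/-! ## §2 The skeleton: the `[001]` projection onto the square net -/

/-- **The planar skeleton of the diamond lattice**: the bcc rotated skeleton `((x₀+x₁)/2, (x₀−x₁)/2)` on diamond sites.
[cite: KozmaNitzan2024, §4 p. 16 (the lattice ℤ² of Lemma 8)] [cite: ConwaySloane1999, Ch. 4 §7.3] -/
def diamondSkel (x : diamondSite) : Site 2 := bccSkel (toBcc x)

/-- `diamondSkel = bccSkel ∘ toBcc`. [folklore] -/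
theorem diamondSkel_eq (x : diamondSite) : diamondSkel x = bccSkel (toBcc x) := rfl

/-- `2 φ₀(x) = x₀ + x₁`. [folklore] -/
theorem two_mul_diamondSkel_zero (x : diamondSite) : 2 * diamondSkel x 0 = (x : Site 3) 0 + (x : Site 3) 1 :=
  two_mul_bccSkel_zero (toBcc x)

/-- `2 φ₁(x) = x₀ − x₁`. [folklore] -/
theorem two_mul_diamondSkel_one (x : diamondSite) : 2 * diamondSkel x 1 = (x : Site 3) 0 - (x : Site 3) 1 :=
  two_mul_bccSkel_one (toBcc x)

/-- The skeleton of the origin is the origin. [folklore] -/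
@[simp] theorem diamondSkel_origin : diamondSkel diamondOrigin = 0 := bccSkel_origin

/-- **The diamond skeleton is `1`-Lipschitz for the sup-norm** along bonds. [folklore] -/
theorem diamondSkel_lipschitz {x y : diamondSite} (h : diamondGraph.Adj x y) (i : Fin 2) :
    |diamondSkel x i - diamondSkel y i| ≤ 1 :=
  bccSkel_lipschitz (x := toBcc x) (y := toBcc y) h i

/-- **The diamond skeleton is a graph homomorphism to the square lattice.** [folklore] -/
theorem zdGraph_adj_diamondSkel {x y : diamondSite} (h : diamondGraph.Adj x y) : (zdGraph 2).Adj (diamondSkel x) (diamondSkel y) :=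
  zdGraph_adj_bccSkel (x := toBcc x) (y := toBcc y) h

/-! ## §3 The four bonds at a site: exactly one per skeleton direction -/

/-- The fibre sign of a site: `+1` on the even sublattice, `−1` on the odd one. [folklore] -/
def fibreSign (x : Site 3) : ℤ := 1 - 2 * (x 2 % 2)

/-- The fibre sign is `±1`. [folklore] -/
theorem fibreSign_eq (x : Site 3) : fibreSign x = 1 ∨ fibreSign x = -1 := by
  unfold fibreSign; omega

/-- **The bond of a diamond site in skeleton direction `σ e_i`**: `(σ, ±σ, κ)` with fibre component `κ = +fibreSign` for `i = 0` and
`−fibreSign` for `i = 1` (from an even site: east/west bonds go UP, north/south bonds go DOWN; from an odd site the reverse).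
[cite: ConwaySloane1999, Ch. 4 §7.3] -/
def bondVec (x : Site 3) (i : Fin 2) (σ : ℤ) : Site 3 :=
  ![σ, if i = 0 then σ else -σ, if i = 0 then fibreSign x else -fibreSign x]

/-- Coordinates of `bondVec`. [folklore] -/
@[simp] theorem bondVec_zero (x : Site 3) (i : Fin 2) (σ : ℤ) : bondVec x i σ 0 = σ := rfl
/-- Coordinates of `bondVec`. [folklore] -/
@[simp] theorem bondVec_one (x : Site 3) (i : Fin 2) (σ : ℤ) : bondVec x i σ 1 = if i = 0 then σ else -σ := rfl
/-- Coordinates of `bondVec`. [folklore] -/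
@[simp] theorem bondVec_two (x : Site 3) (i : Fin 2) (σ : ℤ) :
    bondVec x i σ 2 = if i = 0 then fibreSign x else -fibreSign x := rfl

/-- The bond vectors have coordinates `±1`. [folklore] -/
theorem bondVec_unit (x : Site 3) (i : Fin 2) {σ : ℤ} (hσ : σ = 1 ∨ σ = -1) (j : Fin 3) :
    bondVec x i σ j = 1 ∨ bondVec x i σ j = -1 := by
  have hκ := fibreSign_eq x
  rcases (show j = 0 ∨ j = 1 ∨ j = 2 by fin_cases j <;> simp) with rfl | rfl | rfl
  · rw [bondVec_zero]; exact hσ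
  · rw [bondVec_one]
    rcases (show i = 0 ∨ i = 1 by fin_cases i <;> simp) with rfl | rfl
    · rw [if_pos rfl]; exact hσ
    · rw [if_neg (by decide)]; omega
  · rw [bondVec_two]
    rcases (show i = 0 ∨ i = 1 by fin_cases i <;> simp) with rfl | rfl
    · rw [if_pos rfl]; exact hκ
    · rw [if_neg (by decide)]; omega

/-- **The bond endpoint is again a diamond site.** [cite: ConwaySloane1999, Ch. 4 §7.3] -/
theorem add_bondVec_mem (x : diamondSite) (i : Fin 2) {σ : ℤ} (hσ : σ = 1 ∨ σ = -1) :
    (x : Site 3) + bondVec x i σ ∈ diamondSite := by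
  obtain ⟨h0, h1, h2⟩ := x.2
  simp only [mem_diamondSite_iff, Pi.add_apply, bondVec_zero, bondVec_one, bondVec_two, fibreSign]
  rcases (show i = 0 ∨ i = 1 by fin_cases i <;> simp) with rfl | rfl
  · rw [if_pos rfl, if_pos rfl]
    rcases hσ with rfl | rfl <;> omega
  · rw [if_neg (by decide), if_neg (by decide)]
    rcases hσ with rfl | rfl <;> omega

/-- The bond endpoint as a vertex of the diamond lattice. [folklore] -/
def bondEnd (x : diamondSite) (i : Fin 2) {σ : ℤ} (hσ : σ = 1 ∨ σ = -1) : diamondSite :=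
  ⟨(x : Site 3) + bondVec x i σ, add_bondVec_mem x i hσ⟩

/-- Coordinates of the bond endpoint. [folklore] -/
@[simp] theorem coe_bondEnd (x : diamondSite) (i : Fin 2) {σ : ℤ} (hσ : σ = 1 ∨ σ = -1) :
    ((bondEnd x i hσ : diamondSite) : Site 3) = (x : Site 3) + bondVec x i σ := rfl

/-- **The bond is an edge of the diamond lattice.** [cite: ConwaySloane1999, Ch. 4 §7.3] -/
theorem diamondGraph_adj_bondEnd (x : diamondSite) (i : Fin 2) {σ : ℤ} (hσ : σ = 1 ∨ σ = -1) :
    diamondGraph.Adj x (bondEnd x i hσ) :=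
  BccConc.bccGraph_adj_addUnit (toBcc x) (bondVec_unit x i hσ)

/-- **The bond moves the skeleton by `σ e_i`.** [folklore] -/
theorem diamondSkel_bondEnd (x : diamondSite) (i : Fin 2) {σ : ℤ} (hσ : σ = 1 ∨ σ = -1) :
    diamondSkel (bondEnd x i hσ) = diamondSkel x + Pi.single i σ := by
  have hx0 := two_mul_diamondSkel_zero x
  have hx1 := two_mul_diamondSkel_one x
  have hy0 := two_mul_diamondSkel_zero (bondEnd x i hσ)
  have hy1 := two_mul_diamondSkel_one (bondEnd x i hσ)
  have ey0 : ((bondEnd x i hσ : diamondSite) : Site 3) 0 = (x : Site 3) 0 + σ := rfl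
  have ey1 : ((bondEnd x i hσ : diamondSite) : Site 3) 1 = (x : Site 3) 1 + (if i = 0 then σ else -σ) := rfl
  rw [ey0] at hy0 hy1
  rw [ey1] at hy0 hy1
  ext j
  rcases (show i = 0 ∨ i = 1 by fin_cases i <;> simp) with rfl | rfl <;> rcases (show j = 0 ∨ j = 1 by fin_cases j <;> simp) with rfl | rfl
  · rw [if_pos rfl] at hy0 hy1
    rw [Pi.add_apply, Pi.single_eq_same]; omega
  · rw [if_pos rfl] at hy0 hy1
    rw [Pi.add_apply, Pi.single_eq_of_ne (by decide)]; omega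
  · rw [if_neg (by decide)] at hy0 hy1
    rw [Pi.add_apply, Pi.single_eq_of_ne (by decide)]; omega
  · rw [if_neg (by decide)] at hy0 hy1
    rw [Pi.add_apply, Pi.single_eq_same]; omega

/-- **(ι) OUTWARD STEPS**: at every diamond site, for every skeleton axis and sign, a bond moving the skeleton by `σ e_i`.
[cite: KozmaNitzan2024, §4 p. 16] -/
theorem diamond_step (v : diamondSite) (i : Fin 2) (σ : ℤˣ) :
    ∃ v' : diamondSite, diamondGraph.Adj v v' ∧ diamondSkel v' = diamondSkel v + Pi.single i (σ : ℤ) := by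
  have hσ : (σ : ℤ) = 1 ∨ (σ : ℤ) = -1 := by
    rcases Int.units_eq_one_or σ with rfl | rfl <;> simp
  exact ⟨bondEnd v i hσ, diamondGraph_adj_bondEnd v i hσ, diamondSkel_bondEnd v i hσ⟩

/-- **The skeleton is a weak covering map onto the square lattice**: the neighbours of `x` map ONTO the four neighbours of `φ(x)` in `ℤ²`.
[cite: BenjaminiSchramm1996, Thm. 1] [cite: LyonsPeres2016, §6.9 and Thm. 6.47] -/
theorem diamondSkel_surjOn (x : diamondSite) :
    Set.SurjOn diamondSkel (diamondGraph.neighborSet x) ((zdGraph 2).neighborSet (diamondSkel x)) := by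
  intro w hw
  rw [SimpleGraph.mem_neighborSet, zdGraph_adj_iff] at hw
  obtain ⟨i, h | h⟩ := hw
  · obtain ⟨v', hadj, hv'⟩ := diamond_step x i 1
    exact ⟨v', hadj, by rw [hv', h, Units.val_one]⟩
  · obtain ⟨v', hadj, hv'⟩ := diamond_step x i (-1)
    refine ⟨v', hadj, ?_⟩
    rw [hv', Units.val_neg, Units.val_one]
    have : w = diamondSkel x - Pi.single i 1 := eq_sub_of_add_eq h.symm
    rw [this, sub_eq_add_neg, ← Pi.single_neg]

/-! ## §5 Frames: even translations and glides; vertex-transitivity -/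

/-- The frame map attached to a site `v`: `w ↦ (w₀+v₀, w₁+v₁, w₂+v₂)` if `v` is even, `w ↦ (w₀+v₀, w₁+v₁, v₂−w₂)` (a glide) if `v` is odd.
[cite: ConwaySloane1999, Ch. 4 §7.3] -/
def frameFun (v w : Site 3) : Site 3 :=
  ![w 0 + v 0, w 1 + v 1, if v 2 % 2 = 0 then w 2 + v 2 else v 2 - w 2]

/-- The inverse frame map. [folklore] -/
def frameInv (v w : Site 3) : Site 3 :=
  ![w 0 - v 0, w 1 - v 1, if v 2 % 2 = 0 then w 2 - v 2 else v 2 - w 2]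

/-- Coordinates of `frameFun`. [folklore] -/
@[simp] theorem frameFun_zero (v w : Site 3) : frameFun v w 0 = w 0 + v 0 := rfl
/-- Coordinates of `frameFun`. [folklore] -/
@[simp] theorem frameFun_one (v w : Site 3) : frameFun v w 1 = w 1 + v 1 := rfl
/-- Coordinates of `frameFun`. [folklore] -/
@[simp] theorem frameFun_two (v w : Site 3) : frameFun v w 2 = if v 2 % 2 = 0 then w 2 + v 2 else v 2 - w 2 := rfl
/-- Coordinates of `frameInv`. [folklore] -/
@[simp] theorem frameInv_zero (v w : Site 3) : frameInv v w 0 = w 0 - v 0 := rfl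
/-- Coordinates of `frameInv`. [folklore] -/
@[simp] theorem frameInv_one (v w : Site 3) : frameInv v w 1 = w 1 - v 1 := rfl
/-- Coordinates of `frameInv`. [folklore] -/
@[simp] theorem frameInv_two (v w : Site 3) : frameInv v w 2 = if v 2 % 2 = 0 then w 2 - v 2 else v 2 - w 2 := rfl

/-- The frame map preserves the diamond structure. [cite: ConwaySloane1999, Ch. 4 §7.3] -/
theorem frameFun_mem {v w : Site 3} (hv : v ∈ diamondSite) (hw : w ∈ diamondSite) : frameFun v w ∈ diamondSite := by
  obtain ⟨hv0, hv1, hv2⟩ := hv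
  obtain ⟨hw0, hw1, hw2⟩ := hw
  simp only [mem_diamondSite_iff, frameFun_zero, frameFun_one, frameFun_two]
  split_ifs with h <;> omega

/-- The inverse frame map preserves the diamond structure. [folklore] -/
theorem frameInv_mem {v w : Site 3} (hv : v ∈ diamondSite) (hw : w ∈ diamondSite) : frameInv v w ∈ diamondSite := by
  obtain ⟨hv0, hv1, hv2⟩ := hv
  obtain ⟨hw0, hw1, hw2⟩ := hw
  simp only [mem_diamondSite_iff, frameInv_zero, frameInv_one, frameInv_two]
  split_ifs with h <;> omega

/-- `frameInv v` is a left inverse of `frameFun v`. [folklore] -/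
theorem frameInv_frameFun (v w : Site 3) : frameInv v (frameFun v w) = w := by
  ext i
  rcases (show i = 0 ∨ i = 1 ∨ i = 2 by fin_cases i <;> simp) with rfl | rfl | rfl
  · rw [frameInv_zero, frameFun_zero]; ring
  · rw [frameInv_one, frameFun_one]; ring
  · rw [frameInv_two, frameFun_two]
    split_ifs <;> omega

/-- `frameFun v` is a left inverse of `frameInv v`. [folklore] -/
theorem frameFun_frameInv (v w : Site 3) : frameFun v (frameInv v w) = w := by
  ext i
  rcases (show i = 0 ∨ i = 1 ∨ i = 2 by fin_cases i <;> simp) with rfl | rfl | rfl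
  · rw [frameFun_zero, frameInv_zero]; ring
  · rw [frameFun_one, frameInv_one]; ring
  · rw [frameFun_two, frameInv_two]
    split_ifs <;> omega

/-- The frame maps preserve squared distances (the fibre coordinate is shifted or reflected). [folklore] -/
theorem sum_sq_sub_frameFun (v x y : Site 3) :
    ∑ i, (frameFun v x i - frameFun v y i) ^ 2 = ∑ i, (x i - y i) ^ 2 := by
  simp only [Fin.sum_univ_three, frameFun_zero, frameFun_one, frameFun_two]
  split_ifs <;> ring

/-- The frame attached to `v` as a permutation of the diamond sites. [folklore] -/
def diamondFrameEquiv (v : diamondSite) : diamondSite ≃ diamondSite where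
  toFun w := ⟨frameFun v w, frameFun_mem v.2 w.2⟩
  invFun w := ⟨frameInv v w, frameInv_mem v.2 w.2⟩
  left_inv w := Subtype.ext (frameInv_frameFun v w)
  right_inv w := Subtype.ext (frameFun_frameInv v w)

/-- Coordinates of the frame action. [folklore] -/
@[simp] theorem coe_diamondFrameEquiv (v w : diamondSite) :
    ((diamondFrameEquiv v w : diamondSite) : Site 3) = frameFun v w := rfl

/-- **The frame attached to `v` is an automorphism of the diamond lattice** (an even translation, or a glide). [cite: ConwaySloane1999, Ch. 4 §7.3] -/
def diamondFrame (v : diamondSite) : diamondGraph ≃g diamondGraph where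
  toEquiv := diamondFrameEquiv v
  map_rel_iff' := by
    intro a b
    change (distSqGraph 3 3).Adj (frameFun v a) (frameFun v b) ↔ (distSqGraph 3 3).Adj a b
    rw [distSqGraph_adj, distSqGraph_adj, sum_sq_sub_frameFun]
    refine and_congr ?_ Iff.rfl
    have hinj : Function.Injective (frameFun (v : Site 3)) :=
      Function.LeftInverse.injective (frameInv_frameFun (v : Site 3))
    rw [hinj.ne_iff]

/-- `diamondFrame` acts by `frameFun`. [folklore] -/
@[simp] theorem coe_diamondFrame (v w : diamondSite) : ((diamondFrame v w : diamondSite) : Site 3) = frameFun v w := rfl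

/-- **The frame attached to `v` carries the origin to `v`.** [folklore] -/
theorem diamondFrame_origin (v : diamondSite) : diamondFrame v diamondOrigin = v := by
  apply Subtype.ext
  rw [coe_diamondFrame]
  ext i
  have h0 : ((diamondOrigin : diamondSite) : Site 3) = 0 := rfl
  rw [h0]
  rcases (show i = 0 ∨ i = 1 ∨ i = 2 by fin_cases i <;> simp) with rfl | rfl | rfl
  · rw [frameFun_zero, Pi.zero_apply, zero_add]
  · rw [frameFun_one, Pi.zero_apply, zero_add]
  · rw [frameFun_two, Pi.zero_apply]
    split_ifs <;> omega

/-- **Frames translate the skeleton**: `φ(F_v w) = φ w + φ v`. [folklore] -/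
theorem diamondSkel_frame (v w : diamondSite) : diamondSkel (diamondFrame v w) = diamondSkel w + diamondSkel v := by
  have hw0 := two_mul_diamondSkel_zero w
  have hw1 := two_mul_diamondSkel_one w
  have hv0 := two_mul_diamondSkel_zero v
  have hv1 := two_mul_diamondSkel_one v
  have hy0 := two_mul_diamondSkel_zero (diamondFrame v w)
  have hy1 := two_mul_diamondSkel_one (diamondFrame v w)
  have e0 : ((diamondFrame v w : diamondSite) : Site 3) 0 = (w : Site 3) 0 + (v : Site 3) 0 := rfl
  have e1 : ((diamondFrame v w : diamondSite) : Site 3) 1 = (w : Site 3) 1 + (v : Site 3) 1 := rfl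
  rw [e0] at hy0 hy1; rw [e1] at hy0 hy1
  ext j
  rw [Pi.add_apply]
  rcases (show j = 0 ∨ j = 1 by fin_cases j <;> simp) with rfl | rfl <;> omega

/-- **The diamond lattice is vertex-transitive** (Mathlib class): `F_y ∘ F_x⁻¹` carries `x` to `y`. [cite: BenjaminiSchramm1996, §2] -/
theorem isPretransitive_aut_diamond : MulAction.IsPretransitive (diamondGraph ≃g diamondGraph) diamondSite :=
  ⟨fun x y => ⟨(diamondFrame x).symm.trans (diamondFrame y), by
    rw [RelIso.smul_def]
    show diamondFrame y ((diamondFrame x).symm x) = y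
    rw [show (diamondFrame x).symm x = diamondOrigin from (RelIso.symm_apply_eq _).2 (diamondFrame_origin x).symm]
    exact diamondFrame_origin y⟩⟩

/-- The diamond lattice is quasi-transitive. [cite: BenjaminiSchramm1996, §2] -/
theorem diamond_isQuasiTransitive : IsQuasiTransitive diamondGraph :=
  isQuasiTransitive_of_isPretransitive diamondGraph diamondOrigin isPretransitive_aut_diamond

end Summit.CriticalPhenomena.PercolationContinuityZ3.Theorems.Transplant

end
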